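import Summits.CriticalPhenomena.SAWScalingLimit.Theorems.SAWRestrictionRigidityLimitExists
import Summits.CriticalPhenomena.SAWScalingLimit.Theorems.SAWRestrictionRigidityLimitExistsTightNecessity
import Summits.CriticalPhenomena.SAWScalingLimit.Theses.SAWConePseudogroup

/-! Preflight for `ledger route edit route-CriticalPhenomena-SAWConePseudogroup --split LimitExists --glue-by
`Summit.CriticalPhenomena.SAWScalingLimit.Theorems.SAWRestrictionRigidityLimitExists.LimitExists_of_items`:
the landed glue (p145872), typed over the SAWRestrictionRigidity / SAWLoopFugacityFlow twins, closes the
SAWConePseudogroup copy of the crux from the three VERBATIM child signatures by definitional unfolding. -/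

namespace Summit.CriticalPhenomena.SAWScalingLimit.Theses.SAWConePseudogroup.SplitPreflight

/-- child 1 (item stmt-CriticalPhenomena-1372 verbatim). -/
def EventualTight : Prop :=
  ∀ (D : Literature.Probability.RandomPlanarGeometry.DobrushinDomain) (a b : ℝ → Literature.Probability.LatticeModels.Site 2), Literature.Probability.RandomPlanarGeometry.SAW.IsEndpointApprox D a b → ∃ δ₀ : ℝ, 0 < δ₀ ∧ MeasureTheory.IsTightMeasureSet ((fun δ => (Literature.Probability.RandomPlanarGeometry.SAW.law D.carrier δ (a δ) (b δ)).map (fun γ => γ.curve)) '' Set.Ioc 0 δ₀)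

/-- child 2 (item stmt-CriticalPhenomena-4982 verbatim). -/
def SimpleSubseqLimits : Prop :=
  ∀ (D : Literature.Probability.RandomPlanarGeometry.DobrushinDomain) (a b : ℝ → Literature.Probability.LatticeModels.Site 2), Literature.Probability.RandomPlanarGeometry.SAW.IsEndpointApprox D a b → ∀ (s : ℕ → ℝ) (ν : MeasureTheory.Measure (Literature.Probability.RandomPlanarGeometry.CurveClass ℂ)), Filter.Tendsto s Filter.atTop (nhdsWithin 0 (Set.Ioi 0)) → MeasureTheory.IsProbabilityMeasure ν → (∀ f : BoundedContinuousFunction (Literature.Probability.RandomPlanarGeometry.CurveClass ℂ) ℝ, Filter.Tendsto (fun n => ∫ γ, f γ.curve ∂(Literature.Probability.RandomPlanarGeometry.SAW.law D.carrier (s n) (a (s n)) (b (s n)))) Filter.atTop (nhds (∫ x, f x ∂ν))) → ∀ᵐ γ ∂ν, γ ∈ Literature.Probability.RandomPlanarGeometry.CurveClass.simple ∧ γ.source = D.pt 0 ∧ γ.target = D.pt 1 ∧ γ.range ⊆ closure D.carrier ∧ γ.range ∩ frontier D.carrier ⊆ {D.pt 0, D.pt 1}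

/-- child 3 (item stmt-CriticalPhenomena-1369 verbatim). -/
def AvoidanceCocycleLimit : Prop :=
  ∀ (D D' : Literature.Probability.RandomPlanarGeometry.DobrushinDomain) (a b : ℝ → Literature.Probability.LatticeModels.Site 2), Literature.Probability.RandomPlanarGeometry.SAW.IsEndpointApprox D a b → D'.carrier ⊆ D.carrier → D'.pt 0 = D.pt 0 → D'.pt 1 = D.pt 1 → (∃ ε : ℝ, 0 < ε ∧ D'.carrier ∩ Metric.ball (D.pt 0) ε = D.carrier ∩ Metric.ball (D.pt 0) ε ∧ D'.carrier ∩ Metric.ball (D.pt 1) ε = D.carrier ∩ Metric.ball (D.pt 1) ε) → ∃ c : ENNReal, Filter.Tendsto (fun δ => (((Literature.Probability.RandomPlanarGeometry.SAW.law D.carrier δ (a δ) (b δ)).map (fun γ => γ.curve)) (Literature.Probability.RandomPlanarGeometry.CurveClass.rangeSubset (closure D'.carrier)))) (nhdsWithin 0 (Set.Ioi 0)) (nhds c)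

/-- the split glue, concluding the SAWConePseudogroup crux BY NAME. -/
theorem LimitExists_of_subs :
    EventualTight → SimpleSubseqLimits → AvoidanceCocycleLimit →
      Summit.CriticalPhenomena.SAWScalingLimit.Theses.SAWConePseudogroup.LimitExists :=
  Summit.CriticalPhenomena.SAWScalingLimit.Theorems.SAWRestrictionRigidityLimitExists.LimitExists_of_items

/-- same, with the children read as the existing items' decls (dedup twins). -/
theorem LimitExists_of_items' :
    Summit.CriticalPhenomena.SAWScalingLimit.Theses.SAWRestrictionRigidity.EventualTight →
    Summit.CriticalPhenomena.SAWScalingLimit.Theses.SAWLoopFugacityFlow.SimpleSubseqLimits →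
    Summit.CriticalPhenomena.SAWScalingLimit.Theses.SAWRestrictionRigidity.AvoidanceCocycleLimit →
      Summit.CriticalPhenomena.SAWScalingLimit.Theses.SAWConePseudogroup.LimitExists :=
  Summit.CriticalPhenomena.SAWScalingLimit.Theorems.SAWRestrictionRigidityLimitExists.LimitExists_of_items

/-- converse direction for (T): the split loses nothing on the tightness side. -/
theorem eventualTight_of_limitExists' :
    Summit.CriticalPhenomena.SAWScalingLimit.Theses.SAWConePseudogroup.LimitExists → EventualTight :=
  Summit.CriticalPhenomena.SAWScalingLimit.Theorems.SAWRestrictionRigidityLimitExists.eventualTight_of_limitExists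

end Summit.CriticalPhenomena.SAWScalingLimit.Theses.SAWConePseudogroup.SplitPreflight
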